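import Literature.Probability.RandomPlanarGeometry.LoewnerMoebiusClock
import Literature.Probability.RandomPlanarGeometry.RetargetMoebius
import Literature.Probability.RandomPlanarGeometry.LoewnerIdentification
import Literature.Probability.RandomPlanarGeometry.SLERealFlowIto
import Mathlib.Analysis.Calculus.FDeriv.Extend
import HarnessLib
import Literature.Probability.RandomPlanarGeometry.LoewnerTraceLimit

/-!
# Möbius transport of a chordal Loewner chain, I: the image flow of alive points and of `∞`

Topic `Probability/RandomPlanarGeometry`; theorems only. Deterministic half of G. F. Lawler,
*Conformally Invariant Processes in the Plane* (2005), §6.3 (proof of Thm. 6.13 / Prop. 6.14) for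
the re-targeting Möbius map `Φ_x(z) = xz/(z + x) = a + b/(p - z)` (`a = x`, `b = x²`, `p = -x`;
`retargetMoebius`): with the pole data `X` (the gap of the pole, `realFlowStop W p` on `[0, u₁]`,
`u₁ < T_p`, extended continuously and without zeros), the conjugating maps
`h_u = MoebiusPole.conjMap a b p X u`, the capacity clock `clock` and its inverse `υ = invClock`
(`LoewnerMoebiusClock.lean`), and ANY continuous driving function `Û` that agrees with the image
driving function `timeChangedDriver a b X u₁ = driver ∘ υ` on `[0, clock u₁]`:

* `retargetMoebius_eq_conjMap_zero` — `Φ_x = h_0`; `im_conjMap_pos` — `h_u` maps `ℍ` into `ℍ`;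
  `conjMapInv`-free inversion identities `conjMap_invFormula` (`h_u(P - b d₁/(w - A)) = w`);
* `poleFlow_sub_X_eq` — `P_u - X_u = W_u` on `[0, u₁]` (the integrated real Loewner equation);
* `hasDerivWithinAt_imageFlow` — for `z ∈ ℍ` alive at the original time `t ≤ u₁`, the image
  trajectory `r ↦ h_{υ r}(g_{υ r}(z))` solves Loewner's equation driven by `Û` within
  `[0, clock t]`, with values in `ℍ` (`hasDerivAt_conjMap_invClock` at interior times, the
  one-sided derivative at `r = 0` by `hasDerivWithinAt_Ici_of_tendsto_deriv`);
* `coe_clock_lt_swallowingTime_image` — **alive points stay alive**: `T̂_{Φ_x z} > clock t`;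
  `map_image_eq_conjMap` — **the image Loewner map is `ĝ_{clock t} = h_t ∘ g_t ∘ Φ_x⁻¹`** on
  `Φ_x(ℍ ∖ K_t)` (uniqueness of the Loewner flow, closed at the endpoint by continuity);
* `realFlowStop_image_far` — **the real flow of the tracked point `x = Φ_x(∞)` under `Û` is the
  image far point**: `realFlowStop Û x s = (A - driver)(υ s) = -(b d₁/X)(υ s)` on `[0, clock u₁]`
  (`hasDerivAt_farPoint_invClock`, uniqueness, and the positive margin `b d₁/|X|`).

The swallowed points, the hull identity `K̂_{clock t} = Φ_x(K_t)` and the trace follow in part II below.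

## References

* G. F. Lawler, *Conformally Invariant Processes in the Plane*, AMS (2005), §4.6.1, §6.3.
  [Lawler2005]
-/

noncomputable section

open Set Filter Topology Complex MeasureTheory
open UpperHalfPlane (upperHalfPlaneSet)
open scoped NNReal

namespace Literature.Probability.RandomPlanarGeometry

namespace MoebiusTransport

open Loewner MoebiusPole

/-! ### The Möbius map as `h_0`; `h_u` maps `ℍ` into `ℍ` -/

/-- **`Φ_x = h_0`**: `retargetMoebius x z = conjMap x x² (-x) X 0 z` for `z ≠ -x`. [folklore] -/
theorem retargetMoebius_eq_conjMap_zero (x : ℝ) (X : ℝ → ℝ) {z : ℂ} (hz : z ≠ -x) :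
    retargetMoebius x z = conjMap x (x ^ 2) (-x) X 0 z := by
  rw [conjMap_zero, retargetMoebius.apply]
  have hd : z + x ≠ 0 := retargetMoebius.denom_ne_zero hz
  have hd' : ((-x : ℝ) : ℂ) - z ≠ 0 := by
    push_cast
    intro h; apply hd; linear_combination -h
  push_cast
  field_simp
  ring

/-- The imaginary part of `moebiusConjC a b P d₁ d₂ y` is `b d₁ im y/|P - y|²`. [folklore] -/
theorem im_moebiusConjC (a b P d₁ d₂ : ℝ) (y : ℂ) :
    (moebiusConjC a b P d₁ d₂ y).im = b * d₁ * y.im / Complex.normSq ((P : ℂ) - y) := by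
  have h : moebiusConjC a b P d₁ d₂ y =
      ((a - b * d₂ / (2 * d₁) : ℝ) : ℂ) + ((b * d₁ : ℝ) : ℂ) / ((P : ℂ) - y) := by
    rw [moebiusConjC_apply]; push_cast; ring
  rw [h, add_im, ofReal_im, zero_add, div_im, ofReal_im, ofReal_re, sub_re, sub_im, ofReal_re,
    ofReal_im]
  ring

/-- **`h_u` maps the upper half-plane into itself** (`b > 0`, `d₁ > 0`). [folklore] -/
theorem im_moebiusConjC_pos {a b P d₁ d₂ : ℝ} (hb : 0 < b) (hd₁ : 0 < d₁) {y : ℂ} (hy : 0 < y.im) :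
    0 < (moebiusConjC a b P d₁ d₂ y).im := by
  rw [im_moebiusConjC]
  have hne : (P : ℂ) - y ≠ 0 := by
    intro h
    have : ((P : ℂ) - y).im = 0 := by rw [h]; simp
    simp at this; linarith
  exact div_pos (mul_pos (mul_pos hb hd₁) hy) (Complex.normSq_pos.2 hne)

/-- **Inversion of `h_u`**: for `w ≠ A` (`A = a - b d₂/(2d₁)`) and `b d₁ ≠ 0`,
`h_u(P - b d₁/(w - A)) = w`. [folklore] -/
theorem moebiusConjC_invFormula {a b P d₁ d₂ : ℝ} (hbd : (b : ℂ) * d₁ ≠ 0) {w : ℂ}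
    (hw : w ≠ (a : ℂ) - b * d₂ / (2 * d₁)) :
    moebiusConjC a b P d₁ d₂ ((P : ℂ) - b * d₁ / (w - (a - b * d₂ / (2 * d₁)))) = w := by
  rw [moebiusConjC_apply]
  obtain ⟨hb, hd⟩ := mul_ne_zero_iff.1 hbd
  have hw' : w - ((a : ℂ) - b * d₂ / (2 * d₁)) ≠ 0 := sub_ne_zero.2 hw
  have h1 : (P : ℂ) - ((P : ℂ) - b * d₁ / (w - (a - b * d₂ / (2 * d₁)))) =
      b * d₁ / (w - (a - b * d₂ / (2 * d₁))) := by ring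
  rw [h1]
  field_simp
  ring

/-- The inverse formula in the other order: `P - b d₁/(h_u(y) - A) = y` for `y ≠ P`. [folklore] -/
theorem invFormula_moebiusConjC {a b P d₁ d₂ : ℝ} (hbd : (b : ℂ) * d₁ ≠ 0) {y : ℂ} (hy : y ≠ P) :
    (P : ℂ) - b * d₁ / (moebiusConjC a b P d₁ d₂ y - (a - b * d₂ / (2 * d₁))) = y := by
  rw [moebiusConjC_apply]
  obtain ⟨hb, hd⟩ := mul_ne_zero_iff.1 hbd
  have hy' : (P : ℂ) - y ≠ 0 := sub_ne_zero.2 (Ne.symm hy)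
  have h1 : (a : ℂ) - b * d₂ / (2 * d₁) + b * d₁ / ((P : ℂ) - y) - (a - b * d₂ / (2 * d₁)) =
      b * d₁ / ((P : ℂ) - y) := by ring
  rw [h1]
  field_simp
  ring

/-- A point of `ℍ` is not the real number `A`. [folklore] -/
theorem ne_ofReal_of_im_pos {w : ℂ} (hw : 0 < w.im) (r : ℝ) : w ≠ (r : ℂ) := by
  intro h; rw [h] at hw; simp at hw

/-! ### The standing hypotheses -/

section Transport

variable {W : ℝ≥0 → ℝ} {x : ℝ} {X : ℝ → ℝ} {u₁ : ℝ≥0}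
variable (hW : Continuous W) (hx : x ≠ 0) (hXc : Continuous X) (hX0 : ∀ r, X r ≠ 0)
  (hu₁ : (u₁ : WithTop ℝ≥0) < swallowingTime W ((-x : ℝ) : ℂ))
  (hXW : ∀ u : ℝ, u ∈ Icc 0 (u₁ : ℝ) → X u = realFlowStop W (-x) u.toNNReal)

include hW hXW hu₁ in
/-- **`P_u - X_u = W_u`** on `[0, u₁]`: the pole flow by quadrature minus the gap is the driving
function (the real Loewner equation for the pole in integrated form,
`realFlowStop_eq_sub_add_integral`). [cite: Lawler2005, §4.6.1] -/
theorem poleFlow_sub_X_eq {u : ℝ} (hu : u ∈ Icc 0 (u₁ : ℝ)) :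
    poleFlow (-x) X u - X u = W u.toNNReal := by
  have hW0 : (-x : ℝ) ≠ W 0 := by
    intro h
    have h1 : (u₁ : WithTop ℝ≥0) < swallowingTime W ((W 0 : ℝ) : ℂ) := by rw [← h]; exact hu₁
    exact absurd (h1.trans_le (swallowingTime_driving_le W)) (not_lt.2 bot_le)
  have huT : ((u.toNNReal : ℝ≥0) : WithTop ℝ≥0) < swallowingTime W ((-x : ℝ) : ℂ) :=
    lt_of_le_of_lt (WithTop.coe_le_coe.2 (Real.toNNReal_le_iff_le_coe.2 hu.2)) hu₁
  have h := realFlowStop_eq_sub_add_integral hW hW0 huT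
  rw [Real.coe_toNNReal _ hu.1] at h
  rw [hXW u hu, poleFlow, h]
  have hI : ∫ s in (0 : ℝ)..u, 2 / X s = ∫ s in (0 : ℝ)..u, 2 / realFlowStop W (-x) s.toNNReal := by
    refine intervalIntegral.integral_congr fun s hs ↦ ?_
    rw [uIcc_of_le hu.1] at hs
    rw [hXW s ⟨hs.1, hs.2.trans hu.2⟩]
  rw [hI]
  ring

include hx in
/-- `b d₁ ≠ 0` in `ℂ` (`b = x²`). [folklore] -/
theorem bd_ne_zero (u : ℝ) : ((x ^ 2 : ℝ) : ℂ) * poleDeriv X u ≠ 0 :=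
  mul_ne_zero (by exact_mod_cast pow_ne_zero 2 hx) (Complex.ofReal_ne_zero.2 (poleDeriv_pos u).ne')

include hx in
/-- `h_u` maps `ℍ` into `ℍ`. [folklore] -/
theorem im_conjMap_pos (u : ℝ) {y : ℂ} (hy : 0 < y.im) : 0 < (conjMap x (x ^ 2) (-x) X u y).im :=
  im_moebiusConjC_pos (by positivity) (poleDeriv_pos u) hy

/-! ### The image flow of an alive point -/

include hW hx hXc hX0 hu₁ hXW in
/-- **The image trajectory solves Loewner's equation in capacity time, at interior times.** For
`z ∈ ℍ` with maximal `W`-solution `g` alive beyond the original time `t ≤ u₁`, and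
`r ∈ (0, clock t]`, `r ↦ h_{υ r}(g(υ r))` has derivative `2/(h(g) - driver(υ r))` at `r`.
[cite: Lawler2005, §6.3] -/
theorem hasDerivAt_imageFlow {z : ℂ} (hz : 0 < z.im) {g : ℝ → ℂ}
    (hg : IsSolution W z g (swallowingTime W z)) {t : ℝ} (ht : t ∈ Icc 0 (u₁ : ℝ))
    (htz : ((t.toNNReal : ℝ≥0) : WithTop ℝ≥0) < swallowingTime W z) {r : ℝ}
    (hr : r ∈ Ioc 0 (clock (x ^ 2) X t)) :
    HasDerivAt (fun r ↦ conjMap x (x ^ 2) (-x) X (invClock (x ^ 2) X u₁ r)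
        (g (invClock (x ^ 2) X u₁ r)))
      (2 / (conjMap x (x ^ 2) (-x) X (invClock (x ^ 2) X u₁ r) (g (invClock (x ^ 2) X u₁ r)) -
        driver x (x ^ 2) X (invClock (x ^ 2) X u₁ r))) r := by
  have hb : (x ^ 2 : ℝ) ≠ 0 := pow_ne_zero 2 hx
  have hu₁0 : (0 : ℝ) ≤ u₁ := u₁.coe_nonneg
  have hmono := (strictMono_clock hXc hX0 hb (b := x ^ 2)).monotone
  -- `r` is a level strictly inside the range, `υ r ∈ (0, t]`
  have hrmem : r ∈ Icc 0 (clock (x ^ 2) X u₁) := ⟨hr.1.le, hr.2.trans (hmono ht.2)⟩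
  have hrIoo := Icc_subset_Ioo_clock hXc hX0 hb hrmem
  set u := invClock (x ^ 2) X u₁ r with hu
  have humem : u ∈ Icc (0 : ℝ) u₁ := invClock_mem_Icc hXc hX0 hb hu₁0 hrmem
  have hcu : clock (x ^ 2) X u = r := clock_invClock_of_mem hXc hX0 hb hu₁0 (Ioo_subset_Icc_self hrIoo)
  have hu0 : 0 < u := by
    by_contra hle
    have : clock (x ^ 2) X u ≤ clock (x ^ 2) X 0 := hmono (not_lt.1 hle)
    rw [hcu, clock_zero] at this
    exact absurd hr.1 (not_lt.2 this)
  have hut : u ≤ t := by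
    by_contra hlt
    have : clock (x ^ 2) X t < clock (x ^ 2) X u := strictMono_clock hXc hX0 hb (not_le.1 hlt)
    rw [hcu] at this
    exact absurd hr.2 (not_le.2 this)
  -- the original trajectory at `u`
  have huT : ((u.toNNReal : ℝ≥0) : WithTop ℝ≥0) < swallowingTime W z :=
    lt_of_le_of_lt (WithTop.coe_le_coe.2 (Real.toNNReal_le_toNNReal hut)) htz
  have hgu : HasDerivAt g (vectorField W u (g u)) u := hg.hasDerivAt hu0 huT
  have him : 0 < (g u).im := IsSolution.im_pos_holds hW hg hz u hu0.le huT
  have hPX : poleFlow (-x) X u - X u = W u.toNNReal := poleFlow_sub_X_eq hW hu₁ hXW humem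
  have hY : HasDerivAt g (2 / (g u - ((poleFlow (-x) X u - X u : ℝ) : ℂ))) u := by
    rw [hPX]; exact hgu
  have hYP : g u ≠ poleFlow (-x) X u := ne_ofReal_of_im_pos him _
  have hYW : g u ≠ ((poleFlow (-x) X u - X u : ℝ) : ℂ) := ne_ofReal_of_im_pos him _
  exact hasDerivAt_conjMap_invClock hXc hX0 hb hu₁0 hrIoo hY hYP hYW

include hW in
/-- Along the maximal solution from `z ∈ ℍ`, the imaginary part is positive on the whole time
domain (including `u = 0`). [folklore] -/
theorem im_pos_of_mem_timeDomain {z : ℂ} (hz : 0 < z.im) {g : ℝ → ℂ}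
    (hg : IsSolution W z g (swallowingTime W z)) {u : ℝ}
    (hu : u ∈ {t : ℝ | 0 ≤ t ∧ (t.toNNReal : WithTop ℝ≥0) < swallowingTime W z}) : 0 < (g u).im := by
  rcases hu.1.eq_or_lt with h0 | h0
  · subst h0; rw [hg.apply_zero]; exact hz
  · exact IsSolution.im_pos_holds hW hg hz u h0.le hu.2

include hW hXc hX0 in
/-- **Continuity of `u ↦ h_u(g(u))`** on the time domain of the maximal solution `g` from
`z ∈ ℍ` (the coefficients of the Möbius map `h_u` are continuous and `g(u) ∈ ℍ` is off the real
pole `P_u`). [folklore] -/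
theorem continuousOn_conjMap_solution {z : ℂ} (hz : 0 < z.im) {g : ℝ → ℂ}
    (hg : IsSolution W z g (swallowingTime W z)) :
    ContinuousOn (fun u ↦ conjMap x (x ^ 2) (-x) X u (g u))
      {t : ℝ | 0 ≤ t ∧ (t.toNNReal : WithTop ℝ≥0) < swallowingTime W z} := by
  have hform : (fun u ↦ conjMap x (x ^ 2) (-x) X u (g u)) = fun u ↦
      ((x : ℝ) : ℂ) - ((x ^ 2 : ℝ) : ℂ) * (poleDeriv₂ X u : ℂ) / (2 * (poleDeriv X u : ℂ)) +
        ((x ^ 2 : ℝ) : ℂ) * (poleDeriv X u : ℂ) / (((poleFlow (-x) X u : ℝ) : ℂ) - g u) := by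
    funext u; rw [conjMap, moebiusConjC_apply]
  rw [hform]
  have hP : Continuous fun u ↦ ((poleFlow (-x) X u : ℝ) : ℂ) :=
    continuous_ofReal.comp (continuous_poleFlow hXc hX0)
  have hd₁ : Continuous fun u ↦ ((poleDeriv X u : ℝ) : ℂ) :=
    continuous_ofReal.comp (continuous_poleDeriv hXc hX0)
  have hd₂ : Continuous fun u ↦ ((poleDeriv₂ X u : ℝ) : ℂ) :=
    continuous_ofReal.comp (continuous_poleDeriv₂ hXc hX0)
  refine ((continuousOn_const.sub ((continuousOn_const.mul hd₂.continuousOn).div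
    (continuousOn_const.mul hd₁.continuousOn) fun u _ ↦ ?_)).add
    ((continuousOn_const.mul hd₁.continuousOn).div (hP.continuousOn.sub hg.continuousOn)
      fun u hu ↦ ?_))
  · exact mul_ne_zero two_ne_zero (Complex.ofReal_ne_zero.2 (poleDeriv_pos u).ne')
  · exact sub_ne_zero.2 (Ne.symm (ne_ofReal_of_im_pos (im_pos_of_mem_timeDomain hW hz hg hu) _))

include hW hx hXc hX0 hu₁ hXW in
/-- **The image trajectory within `[0, clock t]`, driven by any `Û` agreeing with the image
driving function.** For `z ∈ ℍ` with maximal `W`-solution `g` alive beyond the original time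
`t ∈ (0, u₁]`, and a continuous `Û` with `Û r = driver(υ r)` on `[0, clock u₁]`, the image
trajectory `r ↦ h_{υ r}(g(υ r))` has derivative `2/(h(g) - Û r)` within `[0, clock t]` at every
`r ∈ [0, clock t]` (one-sided at `r = 0`, by the limit of the derivative), and values in `ℍ`.
[cite: Lawler2005, §6.3] -/
theorem hasDerivWithinAt_imageFlow {Û : ℝ≥0 → ℝ}
    (hÛeq : ∀ r : ℝ, r ∈ Icc 0 (clock (x ^ 2) X u₁) → Û r.toNNReal = driver x (x ^ 2) X
      (invClock (x ^ 2) X u₁ r))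
    {z : ℂ} (hz : 0 < z.im) {g : ℝ → ℂ} (hg : IsSolution W z g (swallowingTime W z)) {t : ℝ}
    (ht0 : 0 < t) (ht : t ≤ (u₁ : ℝ)) (htz : ((t.toNNReal : ℝ≥0) : WithTop ℝ≥0) < swallowingTime W z) :
    (∀ r ∈ Icc 0 (clock (x ^ 2) X t), HasDerivWithinAt (fun r ↦ conjMap x (x ^ 2) (-x) X
        (invClock (x ^ 2) X u₁ r) (g (invClock (x ^ 2) X u₁ r)))
      (2 / (conjMap x (x ^ 2) (-x) X (invClock (x ^ 2) X u₁ r) (g (invClock (x ^ 2) X u₁ r)) -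
        Û r.toNNReal)) (Icc 0 (clock (x ^ 2) X t)) r) ∧
    (∀ r ∈ Icc 0 (clock (x ^ 2) X t), conjMap x (x ^ 2) (-x) X (invClock (x ^ 2) X u₁ r)
        (g (invClock (x ^ 2) X u₁ r)) ∈ upperHalfPlaneSet) ∧
    ContinuousOn (fun r ↦ conjMap x (x ^ 2) (-x) X (invClock (x ^ 2) X u₁ r)
        (g (invClock (x ^ 2) X u₁ r))) (Icc 0 (clock (x ^ 2) X t)) := by
  have hb : (x ^ 2 : ℝ) ≠ 0 := pow_ne_zero 2 hx
  have hu₁0 : (0 : ℝ) ≤ u₁ := u₁.coe_nonneg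
  have htI : t ∈ Icc 0 (u₁ : ℝ) := ⟨ht0.le, ht⟩
  have hmono := (strictMono_clock hXc hX0 hb (b := x ^ 2)).monotone
  set S := clock (x ^ 2) X t with hS
  have hSpos : 0 < S := by
    have := strictMono_clock hXc hX0 hb (b := x ^ 2) ht0
    rwa [clock_zero] at this
  have hSle : S ≤ clock (x ^ 2) X u₁ := hmono ht
  set F : ℝ → ℂ := fun r ↦ conjMap x (x ^ 2) (-x) X (invClock (x ^ 2) X u₁ r)
    (g (invClock (x ^ 2) X u₁ r)) with hF
  -- `υ r ∈ [0, t]` on `[0, S]`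
  have hυmem : ∀ r ∈ Icc 0 S, invClock (x ^ 2) X u₁ r ∈ Icc 0 t := by
    intro r hr
    have h1 := invClock_mem_Icc hXc hX0 hb hu₁0 ⟨hr.1, hr.2.trans hSle⟩
    refine ⟨h1.1, ?_⟩
    by_contra hlt
    have : S < clock (x ^ 2) X (invClock (x ^ 2) X u₁ r) := strictMono_clock hXc hX0 hb (not_le.1 hlt)
    rw [clock_invClock_of_mem hXc hX0 hb hu₁0 (Ioo_subset_Icc_self
      (Icc_subset_Ioo_clock hXc hX0 hb ⟨hr.1, hr.2.trans hSle⟩))] at this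
    exact absurd hr.2 (not_le.2 this)
  have hdom : ∀ r ∈ Icc 0 S, invClock (x ^ 2) X u₁ r ∈
      {t : ℝ | 0 ≤ t ∧ (t.toNNReal : WithTop ℝ≥0) < swallowingTime W z} := fun r hr ↦
    ⟨(hυmem r hr).1, lt_of_le_of_lt (WithTop.coe_le_coe.2 (Real.toNNReal_le_toNNReal (hυmem r hr).2)) htz⟩
  have hH : ∀ r ∈ Icc 0 S, F r ∈ upperHalfPlaneSet := fun r hr ↦
    im_conjMap_pos hx _ (im_pos_of_mem_timeDomain hW hz hg (hdom r hr))
  -- continuity on `[0, S]`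
  have hFc : ContinuousOn F (Icc 0 S) :=
    (continuousOn_conjMap_solution hW hXc hX0 hz hg).comp
      (continuous_invClock hXc hX0 hb hu₁0).continuousOn hdom
  -- the derivative at positive levels
  have hder : ∀ r ∈ Ioc 0 S, HasDerivAt F (2 / (F r - driver x (x ^ 2) X
      (invClock (x ^ 2) X u₁ r))) r := fun r hr ↦
    hasDerivAt_imageFlow hW hx hXc hX0 hu₁ hXW hz hg htI htz hr
  refine ⟨fun r hr ↦ ?_, hH, hFc⟩
  have hÛr : Û r.toNNReal = driver x (x ^ 2) X (invClock (x ^ 2) X u₁ r) :=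
    hÛeq r ⟨hr.1, hr.2.trans hSle⟩
  rw [hÛr]
  rcases hr.1.eq_or_lt with hr0 | hr0
  · -- `r = 0`: one-sided derivative as the limit of the derivative on `(0, S)`
    subst hr0
    have hdiff : DifferentiableOn ℝ F (Ioo 0 S) := fun r hr ↦
      (hder r ⟨hr.1, hr.2.le⟩).differentiableAt.differentiableWithinAt
    have hlimF : ContinuousWithinAt F (Ioo 0 S) 0 :=
      (hFc 0 ⟨le_rfl, hSpos.le⟩).mono Ioo_subset_Icc_self
    have hmem : Ioo 0 S ∈ 𝓝[>] (0 : ℝ) := Ioo_mem_nhdsGT hSpos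
    -- the derivative formula is continuous up to `0`
    have hDc : ContinuousOn (fun r ↦ (2 : ℂ) / (F r - driver x (x ^ 2) X
        (invClock (x ^ 2) X u₁ r))) (Icc 0 S) := by
      refine continuousOn_const.div (hFc.sub ((continuous_ofReal.comp
        ((continuous_driver hXc hX0).comp (continuous_invClock hXc hX0 hb hu₁0))).continuousOn))
        fun r hr ↦ sub_ne_zero.2 (ne_ofReal_of_im_pos (hH r hr) _)
    have hlim' : Tendsto (fun r ↦ deriv F r) (𝓝[>] (0 : ℝ))
        (𝓝 (2 / (F 0 - driver x (x ^ 2) X (invClock (x ^ 2) X u₁ 0)))) := by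
      have h1 : Tendsto (fun r ↦ (2 : ℂ) / (F r - driver x (x ^ 2) X (invClock (x ^ 2) X u₁ r)))
          (𝓝[Ioo 0 S] (0 : ℝ)) (𝓝 (2 / (F 0 - driver x (x ^ 2) X (invClock (x ^ 2) X u₁ 0)))) :=
        ((hDc 0 ⟨le_rfl, hSpos.le⟩).mono Ioo_subset_Icc_self).tendsto
      rw [nhdsWithin_Ioo_eq_nhdsGT hSpos] at h1
      refine h1.congr' ?_
      filter_upwards [hmem] with r hr
      exact ((hder r ⟨hr.1, hr.2.le⟩).deriv).symm
    have h := hasDerivWithinAt_Ici_of_tendsto_deriv hdiff hlimF hmem hlim'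
    exact h.mono Icc_subset_Ici_self
  · exact (hder r ⟨hr0, hr.2⟩).hasDerivWithinAt

/-! ### Alive points: the image swallowing time and the image Loewner map -/

include hW hx hXc hX0 hu₁ hXW in
/-- **Alive points stay alive in the image**: if `z ∈ ℍ` is alive at the original time
`t ∈ (0, u₁]`, then `Φ_x(z)` is alive under `Û` at the capacity time `clock t`:
`clock t < T̂_{Φ_x z}` (the image trajectory solves the equation within `[0, clock t]` in `ℍ`,
`coe_lt_swallowingTime_of_hasDerivWithinAt`). [cite: Lawler2005, §6.3] -/
theorem coe_clock_lt_swallowingTime_image {Û : ℝ≥0 → ℝ} (hÛ : Continuous Û)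
    (hÛeq : ∀ r : ℝ, r ∈ Icc 0 (clock (x ^ 2) X u₁) → Û r.toNNReal = driver x (x ^ 2) X
      (invClock (x ^ 2) X u₁ r))
    {z : ℂ} (hz : 0 < z.im) {t : ℝ≥0} (ht0 : 0 < t) (ht : t ≤ u₁)
    (htz : (t : WithTop ℝ≥0) < swallowingTime W z) :
    (((clock (x ^ 2) X t).toNNReal : ℝ≥0) : WithTop ℝ≥0) <
      swallowingTime Û (retargetMoebius x z) := by
  have hb : (x ^ 2 : ℝ) ≠ 0 := pow_ne_zero 2 hx
  have hzW : z ≠ W 0 := ne_ofReal_of_im_pos hz _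
  obtain ⟨g, hg⟩ := exists_isSolution_swallowingTime_holds hW hzW
  have htz' : (((t : ℝ).toNNReal : ℝ≥0) : WithTop ℝ≥0) < swallowingTime W z := by
    rw [Real.toNNReal_coe]; exact htz
  obtain ⟨hder, hH, -⟩ := hasDerivWithinAt_imageFlow hW hx hXc hX0 hu₁ hXW hÛeq hz hg
    (by exact_mod_cast ht0) (by exact_mod_cast ht) htz'
  set S := clock (x ^ 2) X t with hS
  have hSpos : 0 < S := by
    have := strictMono_clock hXc hX0 hb (b := x ^ 2) (show (0 : ℝ) < t by exact_mod_cast ht0)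
    rwa [clock_zero] at this
  have hScoe : ((S.toNNReal : ℝ≥0) : ℝ) = S := Real.coe_toNNReal _ hSpos.le
  have hg0 : conjMap x (x ^ 2) (-x) X (invClock (x ^ 2) X u₁ 0) (g (invClock (x ^ 2) X u₁ 0)) =
      retargetMoebius x z := by
    rw [invClock_zero hXc hX0 hb u₁.coe_nonneg, hg.apply_zero,
      retargetMoebius_eq_conjMap_zero x X (retargetMoebius.ne_neg_of_im_pos hz)]
  refine coe_lt_swallowingTime_of_hasDerivWithinAt hÛ (Real.toNNReal_pos.2 hSpos)
    (g := fun r ↦ conjMap x (x ^ 2) (-x) X (invClock (x ^ 2) X u₁ r) (g (invClock (x ^ 2) X u₁ r)))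
    hg0 (fun r hr ↦ ?_) (fun r hr ↦ ?_)
  · rw [hScoe] at hr ⊢; exact hder r hr
  · rw [hScoe] at hr; exact hH r hr

include hW hx hXc hX0 hu₁ hXW in
/-- **The image Loewner map is the conjugated map**: for `z ∈ ℍ` alive at the original time
`t ∈ (0, u₁]`, `ĝ_{clock t}(Φ_x z) = h_t(g_t(z))`, where `ĝ` is the Loewner map of `Û`
(uniqueness of the Loewner flow on `[0, clock t)`, closed at the endpoint by continuity).
[cite: Lawler2005, §6.3] -/
theorem map_image_eq_conjMap {Û : ℝ≥0 → ℝ} (hÛ : Continuous Û)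
    (hÛeq : ∀ r : ℝ, r ∈ Icc 0 (clock (x ^ 2) X u₁) → Û r.toNNReal = driver x (x ^ 2) X
      (invClock (x ^ 2) X u₁ r))
    {z : ℂ} (hz : 0 < z.im) {t : ℝ≥0} (ht0 : 0 < t) (ht : t ≤ u₁)
    (htz : (t : WithTop ℝ≥0) < swallowingTime W z) :
    map Û (clock (x ^ 2) X t).toNNReal (retargetMoebius x z) =
      conjMap x (x ^ 2) (-x) X t (map W t z) := by
  have hb : (x ^ 2 : ℝ) ≠ 0 := pow_ne_zero 2 hx
  have hzW : z ≠ W 0 := ne_ofReal_of_im_pos hz _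
  obtain ⟨g, hg⟩ := exists_isSolution_swallowingTime_holds hW hzW
  have htz' : (((t : ℝ).toNNReal : ℝ≥0) : WithTop ℝ≥0) < swallowingTime W z := by
    rw [Real.toNNReal_coe]; exact htz
  obtain ⟨hder, hH, hFc⟩ := hasDerivWithinAt_imageFlow hW hx hXc hX0 hu₁ hXW hÛeq hz hg
    (by exact_mod_cast ht0) (by exact_mod_cast ht) htz'
  set S := clock (x ^ 2) X t with hS
  have hSpos : 0 < S := by
    have := strictMono_clock hXc hX0 hb (b := x ^ 2) (show (0 : ℝ) < t by exact_mod_cast ht0)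
    rwa [clock_zero] at this
  have hScoe : ((S.toNNReal : ℝ≥0) : ℝ) = S := Real.coe_toNNReal _ hSpos.le
  set F : ℝ → ℂ := fun r ↦ conjMap x (x ^ 2) (-x) X (invClock (x ^ 2) X u₁ r)
    (g (invClock (x ^ 2) X u₁ r)) with hF
  have hF0 : F 0 = retargetMoebius x z := by
    simp only [hF]
    rw [invClock_zero hXc hX0 hb u₁.coe_nonneg, hg.apply_zero,
      retargetMoebius_eq_conjMap_zero x X (retargetMoebius.ne_neg_of_im_pos hz)]
  -- the image point is alive beyond `S`; its maximal solution
  have halive := coe_clock_lt_swallowingTime_image hW hx hXc hX0 hu₁ hXW hÛ hÛeq hz ht0 ht htz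
  set ζ := retargetMoebius x z with hζ
  have hζ0 : ζ ≠ Û 0 := ne_ofReal_of_im_pos (retargetMoebius.im_pos hx hz) _
  obtain ⟨G, hG⟩ := exists_isSolution_swallowingTime_holds hÛ hζ0
  -- `F` is a `Û`-solution on `[0, S)`
  have hsol : IsSolution Û ζ F S.toNNReal := by
    refine isSolution_of_hasDerivWithinAt hF0 (fun r hr ↦ ?_) (fun r hr ↦ ?_)
    · rw [hScoe] at hr ⊢
      exact (hder r ⟨hr.1, hr.2.le⟩).mono Ico_subset_Icc_self
    · rw [hScoe] at hr; exact hH r ⟨hr.1, hr.2.le⟩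
  -- `F = G` on `[0, S)`, hence at `S` by continuity
  have heqOn : EqOn F G (Ico 0 S) := fun r hr ↦ by
    refine IsSolution.eqOn_holds hÛ hsol hG ⟨hr.1, ?_⟩
    rw [lt_min_iff]
    have h1 : (r.toNNReal : WithTop ℝ≥0) < (S.toNNReal : WithTop ℝ≥0) :=
      WithTop.coe_lt_coe.2 (Real.toNNReal_lt_toNNReal_iff'.2 ⟨hr.2, hSpos⟩)
    exact ⟨h1, h1.trans halive⟩
  have hsubG : Icc 0 S ⊆ {r : ℝ | 0 ≤ r ∧ (r.toNNReal : WithTop ℝ≥0) < swallowingTime Û ζ} := by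
    intro r hr
    exact ⟨hr.1, lt_of_le_of_lt (WithTop.coe_le_coe.2 (Real.toNNReal_le_toNNReal hr.2)) halive⟩
  have heqIcc : EqOn F G (Icc 0 S) :=
    heqOn.of_subset_closure hFc (hG.continuousOn.mono hsubG) Ico_subset_Icc_self
      (by rw [closure_Ico hSpos.ne])
  have hmap : map Û S.toNNReal ζ = G S := by
    rw [map_eq_of_isSolution hÛ hG halive, hScoe]
  rw [hmap, ← heqIcc ⟨hSpos.le, le_rfl⟩]
  simp only [hF]
  have ht' : (t : ℝ) ≤ u₁ := by exact_mod_cast ht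
  rw [invClock_clock hXc hX0 hb u₁.coe_nonneg ⟨by linarith [t.coe_nonneg], by linarith⟩,
    map_eq_of_isSolution hW hg htz]

/-! ### The real flow of the tracked point `x = Φ_x(∞)` -/

include hXc hX0 hx in
/-- **The real flow of `x` under `Û` is the image far point** (as a solution): the function
`r ↦ A_{υ r} = farPoint(υ r)` solves the real Loewner equation driven by `Û` on `[0, clock u₁]`
(`hasDerivAt_farPoint_invClock`), starts at `x`, and never meets the driving function (the
margin is `b d₁/|X| (υ r) > 0`). [cite: Lawler2005, §6.3] -/
theorem isSolution_farPoint {Û : ℝ≥0 → ℝ}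
    (hÛeq : ∀ r : ℝ, r ∈ Icc 0 (clock (x ^ 2) X u₁) → Û r.toNNReal = driver x (x ^ 2) X
      (invClock (x ^ 2) X u₁ r)) :
    IsSolution Û (x : ℂ) (fun r ↦ ((farPoint x (x ^ 2) X (invClock (x ^ 2) X u₁ r) : ℝ) : ℂ))
      (((clock (x ^ 2) X u₁).toNNReal : ℝ≥0) : WithTop ℝ≥0) := by
  have hb : (x ^ 2 : ℝ) ≠ 0 := pow_ne_zero 2 hx
  have hu₁0 : (0 : ℝ) ≤ u₁ := u₁.coe_nonneg
  have hS0 : 0 ≤ clock (x ^ 2) X u₁ := clock_nonneg hXc hX0 hb hu₁0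
  have hScoe : (((clock (x ^ 2) X u₁).toNNReal : ℝ≥0) : ℝ) = clock (x ^ 2) X u₁ :=
    Real.coe_toNNReal _ hS0
  have hdom : {r : ℝ | 0 ≤ r ∧ (r.toNNReal : WithTop ℝ≥0) <
      (((clock (x ^ 2) X u₁).toNNReal : ℝ≥0) : WithTop ℝ≥0)} = Ico 0 (clock (x ^ 2) X u₁) := by
    ext r; rw [mem_timeDomain_coe_iff, hScoe]; rfl
  refine ⟨?_, ?_, ?_⟩
  · show ((farPoint x (x ^ 2) X (invClock (x ^ 2) X u₁ 0) : ℝ) : ℂ) = x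
    rw [invClock_zero hXc hX0 hb hu₁0, farPoint_zero]
  · intro r hr
    rw [hdom] at hr ⊢
    have hrI : r ∈ Icc 0 (clock (x ^ 2) X u₁) := ⟨hr.1, hr.2.le⟩
    have hrIoo := Icc_subset_Ioo_clock hXc hX0 hb hrI
    have h := (hasDerivAt_farPoint_invClock (a := x) hXc hX0 hb hu₁0 hrIoo).ofReal_comp
    rw [vectorField_apply, hÛeq r hrI]
    refine h.hasDerivWithinAt.congr_deriv ?_
    push_cast
    rfl
  · intro r hr0 hrS
    have hr : r ∈ Icc 0 (clock (x ^ 2) X u₁) := by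
      have : r ∈ Ico 0 (clock (x ^ 2) X u₁) := by rw [← hdom]; exact ⟨hr0, hrS⟩
      exact ⟨this.1, this.2.le⟩
    rw [hÛeq r hr]
    intro h
    have h' : farPoint x (x ^ 2) X (invClock (x ^ 2) X u₁ r) =
        driver x (x ^ 2) X (invClock (x ^ 2) X u₁ r) := by
      have h1 := h; simp only at h1; exact_mod_cast h1
    have h2 := farPoint_sub_driver (a := x) (b := x ^ 2) (X := X) (invClock (x ^ 2) X u₁ r)
    rw [h', sub_self] at h2
    have : x ^ 2 * poleDeriv X (invClock (x ^ 2) X u₁ r) / X (invClock (x ^ 2) X u₁ r) ≠ 0 :=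
      div_ne_zero (mul_ne_zero hb (poleDeriv_pos _).ne') (hX0 _)
    exact this (by linarith)

include hXc hX0 hx in
/-- **The real flow of the tracked point `x` under `Û` is `(A - driver)(υ s) = -(b d₁/X)(υ s)`**
for `s ≤ clock u₁` (`clock u₁ > 0`): the far-point solution has the positive margin `b d₁/|X|` on
`[0, clock u₁]`, so `x` is alive beyond `clock u₁`
(`IsSolution.coe_lt_swallowingTime_of_le_norm_sub`), its Loewner map is the far point
(uniqueness, closed at the endpoint by continuity), and `realFlowStop = re ĝ(x) - Û`.
[cite: Lawler2005, §6.3] -/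
theorem realFlowStop_image_far {Û : ℝ≥0 → ℝ} (hÛ : Continuous Û)
    (hÛeq : ∀ r : ℝ, r ∈ Icc 0 (clock (x ^ 2) X u₁) → Û r.toNNReal = driver x (x ^ 2) X
      (invClock (x ^ 2) X u₁ r)) (hpos : 0 < clock (x ^ 2) X u₁)
    {s : ℝ≥0} (hs : (s : ℝ) ≤ clock (x ^ 2) X u₁) :
    (s : WithTop ℝ≥0) < swallowingTime Û x ∧
    realFlowStop Û x s = -(x ^ 2 * poleDeriv X (invClock (x ^ 2) X u₁ s) /
      X (invClock (x ^ 2) X u₁ s)) := by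
  have hb : (x ^ 2 : ℝ) ≠ 0 := pow_ne_zero 2 hx
  have hu₁0 : (0 : ℝ) ≤ u₁ := u₁.coe_nonneg
  set S := clock (x ^ 2) X u₁ with hSdef
  have hScoe : ((S.toNNReal : ℝ≥0) : ℝ) = S := Real.coe_toNNReal _ hpos.le
  set A : ℝ → ℂ := fun r ↦ ((farPoint x (x ^ 2) X (invClock (x ^ 2) X u₁ r) : ℝ) : ℂ) with hA
  have hsol : IsSolution Û (x : ℂ) A (S.toNNReal : WithTop ℝ≥0) :=
    isSolution_farPoint hx hXc hX0 hÛeq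
  -- the margin `b d₁/|X| ∘ υ` is bounded below on `[0, S]`
  have hmc : Continuous fun r ↦ |x ^ 2 * poleDeriv X (invClock (x ^ 2) X u₁ r) /
      X (invClock (x ^ 2) X u₁ r)| :=
    continuous_abs.comp (((continuous_const.mul (continuous_poleDeriv hXc hX0)).div hXc hX0).comp
      (continuous_invClock hXc hX0 hb hu₁0))
  have hmpos : ∀ r, 0 < |x ^ 2 * poleDeriv X (invClock (x ^ 2) X u₁ r) /
      X (invClock (x ^ 2) X u₁ r)| := fun r ↦
    abs_pos.2 (div_ne_zero (mul_ne_zero hb (poleDeriv_pos _).ne') (hX0 _))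
  obtain ⟨r₀, -, hmin⟩ := (isCompact_Icc (a := (0 : ℝ)) (b := S)).exists_isMinOn
    ⟨0, left_mem_Icc.2 hpos.le⟩ hmc.continuousOn
  set δ : ℝ := |x ^ 2 * poleDeriv X (invClock (x ^ 2) X u₁ r₀) / X (invClock (x ^ 2) X u₁ r₀)|
    with hδ
  have hδpos : 0 < δ := hmpos r₀
  have hfar : ∀ r : ℝ, 0 ≤ r → r < S.toNNReal → δ ≤ ‖A r - Û r.toNNReal‖ := by
    intro r hr0 hrS
    rw [hScoe] at hrS
    have hr : r ∈ Icc 0 S := ⟨hr0, hrS.le⟩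
    have h1 : A r - Û r.toNNReal = -(((x ^ 2 * poleDeriv X (invClock (x ^ 2) X u₁ r) /
        X (invClock (x ^ 2) X u₁ r) : ℝ) : ℂ)) := by
      simp only [hA]
      rw [hÛeq r hr, ← Complex.ofReal_sub, farPoint_sub_driver]
      push_cast; ring
    rw [h1, norm_neg, Complex.norm_real, Real.norm_eq_abs]
    exact hmin hr
  have halive : ((S.toNNReal : ℝ≥0) : WithTop ℝ≥0) < swallowingTime Û (x : ℂ) :=
    hsol.coe_lt_swallowingTime_of_le_norm_sub hÛ (Real.toNNReal_pos.2 hpos)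
      (δ := ⟨δ, hδpos.le⟩) hδpos hfar
  -- the maximal solution from `x` agrees with `A` on `[0, S]`
  have hxÛ : (x : ℂ) ≠ Û 0 := ne_driving_of_lt_swallowingTime (lt_of_le_of_lt bot_le halive)
  obtain ⟨G, hG⟩ := exists_isSolution_swallowingTime_holds hÛ hxÛ
  have heqOn : EqOn A G (Ico 0 S) := fun r hr ↦ by
    refine IsSolution.eqOn_holds hÛ hsol hG ⟨hr.1, ?_⟩
    rw [lt_min_iff]
    have h1 : (r.toNNReal : WithTop ℝ≥0) < (S.toNNReal : WithTop ℝ≥0) :=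
      WithTop.coe_lt_coe.2 (Real.toNNReal_lt_toNNReal_iff'.2 ⟨hr.2, hpos⟩)
    exact ⟨h1, h1.trans halive⟩
  have hsubG : Icc 0 S ⊆ {r : ℝ | 0 ≤ r ∧ (r.toNNReal : WithTop ℝ≥0) < swallowingTime Û x} := by
    intro r hr
    exact ⟨hr.1, lt_of_le_of_lt (WithTop.coe_le_coe.2 (Real.toNNReal_le_toNNReal hr.2)) halive⟩
  have hAc : ContinuousOn A (Icc 0 S) :=
    (Complex.continuous_ofReal.comp ((continuous_farPoint hXc hX0).comp
      (continuous_invClock hXc hX0 hb hu₁0))).continuousOn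
  have heqIcc : EqOn A G (Icc 0 S) :=
    heqOn.of_subset_closure hAc (hG.continuousOn.mono hsubG) Ico_subset_Icc_self
      (by rw [closure_Ico hpos.ne])
  -- read off the real flow at `s`
  have hsS : (s : ℝ) ∈ Icc 0 S := ⟨s.coe_nonneg, hs⟩
  have hsT : (s : WithTop ℝ≥0) < swallowingTime Û x := by
    have := (hsubG hsS).2; rwa [Real.toNNReal_coe] at this
  refine ⟨hsT, ?_⟩
  rw [realFlowStop_of_lt hsT, realFlow_eq_re_sub hÛ hG hsT, ← heqIcc hsS]
  simp only [hA, Complex.ofReal_re]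
  have hÛs : Û s = driver x (x ^ 2) X (invClock (x ^ 2) X u₁ s) := by
    have := hÛeq s hsS; rwa [Real.toNNReal_coe] at this
  rw [hÛs, farPoint_sub_driver]

end Transport

end MoebiusTransport

end Literature.Probability.RandomPlanarGeometry

end


/-!
# Möbius transport of a chordal Loewner chain, II: swallowed points, hulls and the trace

Topic `Probability/RandomPlanarGeometry`; theorems only, second part (G. F. Lawler (2005), §6.3, proof of Thm. 6.13 / Prop. 6.14
for the Möbius map `Φ_x = a + b/(p - ·)`, `a = x`, `b = x²`, `p = -x`; image driving function
`Û = driver ∘ υ` on `[0, clock u₁]`, `u₁ < T_p`):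

* `im_invMoebius_pos`, `continuousOn_invPullback` — the inverse Möbius map
  `w ↦ P - b d₁/(w - A)` maps `ℍ` into `ℍ`; the pull-back `u ↦ h_u⁻¹(Ĝ(clock u))` of an image
  trajectory is continuous;
* `swallowingTime_image_le` — **swallowed points are swallowed in the image, no later than the
  clock of their swallowing time**: if `T_z = τ ≤ u₁` then `T̂_{Φ_x z} ≤ clock τ` (otherwise
  the pull-back of the image trajectory would extend `g(z)` continuously into `ℍ` at `τ`,
  contradicting `inf_{t<τ} |g_t(z) - W_t| = 0`, `IsSolution.exists_norm_sub_lt`);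
* `hull_image_eq` — **`K̂_{clock t} = Φ_x(K_t)`** for `t ∈ (0, u₁]`; `domain_image_eq`;
* `trace_image_eq` — **the generating curve of the image chain is `Φ_x ∘ γ ∘ υ`**:
  `γ̂(clock t) = Φ_x(γ t)` for `t ∈ (0, u₁]`, whenever both chains are generated by curves and
  `γ` avoids the pole on `[0, u₁]` (the tip is the boundary limit of the inverse Loewner map,
  `IsGeneratedByCurve.tendsto_invFunOn_map`, and the inverse image map is
  `Φ_x ∘ f_t ∘ h_t⁻¹` by `map_image_eq_conjMap`).

## References

* G. F. Lawler, *Conformally Invariant Processes in the Plane*, AMS (2005), §4.4 (Prop. 4.27,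
  Prop. 4.31), §6.3. [Lawler2005]
-/

noncomputable section

open Set Filter Topology Complex MeasureTheory
open UpperHalfPlane (upperHalfPlaneSet)
open scoped NNReal

namespace Literature.Probability.RandomPlanarGeometry

namespace MoebiusTransport

open Loewner MoebiusPole

/-! ### The inverse Möbius map -/

/-- **The inverse Möbius map `w ↦ P - c/(w - A)` maps `ℍ` into `ℍ`** (`c > 0`):
`im = c im w/|w - A|²`. [folklore] -/
theorem im_invMoebius_pos {P c A : ℝ} (hc : 0 < c) {w : ℂ} (hw : 0 < w.im) :
    0 < ((P : ℂ) - c / (w - A)).im := by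
  have hne : w - (A : ℂ) ≠ 0 := sub_ne_zero.2 (ne_ofReal_of_im_pos hw A)
  rw [sub_im, ofReal_im, zero_sub, div_im]
  simp only [ofReal_im, ofReal_re, sub_re, sub_im, zero_mul, zero_div, zero_sub]
  rw [neg_neg, sub_zero]
  exact div_pos (mul_pos hc hw) (Complex.normSq_pos.2 hne)

section Transport

variable {W : ℝ≥0 → ℝ} {x : ℝ} {X : ℝ → ℝ} {u₁ : ℝ≥0}
variable (hW : Continuous W) (hx : x ≠ 0) (hXc : Continuous X) (hX0 : ∀ r, X r ≠ 0)
  (hu₁ : (u₁ : WithTop ℝ≥0) < swallowingTime W ((-x : ℝ) : ℂ))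
  (hXW : ∀ u : ℝ, u ∈ Icc 0 (u₁ : ℝ) → X u = realFlowStop W (-x) u.toNNReal)

/-! ### Swallowed points -/

include hW hx hXc hX0 hu₁ hXW in
/-- **Swallowed points are swallowed in the image**: if `z ∈ ℍ` has swallowing time
`T_z = τ ∈ (0, u₁]`, then `T̂_{Φ_x z} ≤ clock τ`. Otherwise the maximal image solution `Ĝ`
lives in `ℍ` up to and including the level `clock τ`; pulling it back by `h_u⁻¹` gives a
continuous function on `[0, τ]` equal to `g(z)` before `τ` (`map_image_eq_conjMap` and the
inversion formula), with value in `ℍ` at `τ`, so `|g_t(z) - W_t| ≥ im g_t(z)` stays bounded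
below on `[0, τ)` — contradicting `IsSolution.exists_norm_sub_lt`. [cite: Lawler2005, §6.3] -/
theorem swallowingTime_image_le {Û : ℝ≥0 → ℝ} (hÛ : Continuous Û)
    (hÛeq : ∀ r : ℝ, r ∈ Icc 0 (clock (x ^ 2) X u₁) → Û r.toNNReal = driver x (x ^ 2) X
      (invClock (x ^ 2) X u₁ r))
    {z : ℂ} (hz : 0 < z.im) {τ : ℝ≥0} (hτ : swallowingTime W z = τ) (hτu : τ ≤ u₁) :
    swallowingTime Û (retargetMoebius x z) ≤ (clock (x ^ 2) X τ).toNNReal := by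
  have hb : (x ^ 2 : ℝ) ≠ 0 := pow_ne_zero 2 hx
  have hu₁0 : (0 : ℝ) ≤ u₁ := u₁.coe_nonneg
  have hmono := (strictMono_clock hXc hX0 hb (b := x ^ 2)).monotone
  have hzW : z ≠ W 0 := ne_ofReal_of_im_pos hz _
  have hτpos : 0 < τ := by
    have := swallowingTime_pos_holds hW hzW; rwa [hτ, WithTop.coe_pos] at this
  have hτpos' : (0 : ℝ) < τ := hτpos
  set S := clock (x ^ 2) X τ with hSdef
  have hSpos : 0 < S := by
    have := strictMono_clock hXc hX0 hb (b := x ^ 2) hτpos'; rwa [clock_zero] at this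
  have hScoe : ((S.toNNReal : ℝ≥0) : ℝ) = S := Real.coe_toNNReal _ hSpos.le
  by_contra hlt
  rw [not_le] at hlt
  -- the maximal solutions
  obtain ⟨g, hg⟩ := exists_isSolution_swallowingTime_holds hW hzW
  set ζ := retargetMoebius x z with hζ
  have hζim : 0 < ζ.im := retargetMoebius.im_pos hx hz
  have hζ0 : ζ ≠ Û 0 := ne_ofReal_of_im_pos hζim _
  obtain ⟨G, hG⟩ := exists_isSolution_swallowingTime_holds hÛ hζ0
  -- `G(clock u) = h_u(g u)` for `u ∈ (0, τ)`
  have hGg : ∀ u : ℝ≥0, 0 < u → u < τ → G (clock (x ^ 2) X u) = conjMap x (x ^ 2) (-x) X u (g u) := by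
    intro u hu0 huτ
    have huz : (u : WithTop ℝ≥0) < swallowingTime W z := by rw [hτ]; exact WithTop.coe_lt_coe.2 huτ
    have h1 := map_image_eq_conjMap hW hx hXc hX0 hu₁ hXW hÛ hÛeq hz hu0 (huτ.le.trans hτu) huz
    have hcu : ((clock (x ^ 2) X u).toNNReal : WithTop ℝ≥0) < swallowingTime Û ζ := by
      refine lt_trans ?_ hlt
      exact WithTop.coe_lt_coe.2 (Real.toNNReal_lt_toNNReal_iff'.2
        ⟨strictMono_clock hXc hX0 hb (NNReal.coe_lt_coe.2 huτ), hSpos⟩)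
    rw [map_eq_of_isSolution hÛ hG hcu, map_eq_of_isSolution hW hg huz,
      Real.coe_toNNReal _ (clock_nonneg hXc hX0 hb u.coe_nonneg)] at h1
    exact h1
  -- the pull-back `u ↦ h_u⁻¹(G(clock u))` on `[0, τ]`
  set ψ : ℝ → ℂ := fun u ↦ ((poleFlow (-x) X u : ℝ) : ℂ) -
    ((x ^ 2 : ℝ) : ℂ) * (poleDeriv X u : ℂ) / (G (clock (x ^ 2) X u) -
      (((x : ℝ) : ℂ) - ((x ^ 2 : ℝ) : ℂ) * (poleDeriv₂ X u : ℂ) / (2 * (poleDeriv X u : ℂ))))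
    with hψ
  -- the time domain of `G` contains `clock '' [0, τ]`
  have hdomG : ∀ u ∈ Icc (0 : ℝ) τ, clock (x ^ 2) X u ∈
      {r : ℝ | 0 ≤ r ∧ (r.toNNReal : WithTop ℝ≥0) < swallowingTime Û ζ} := by
    intro u hu
    refine ⟨clock_nonneg hXc hX0 hb hu.1, lt_of_le_of_lt ?_ hlt⟩
    exact WithTop.coe_le_coe.2 (Real.toNNReal_le_toNNReal (hmono hu.2))
  have hGim : ∀ u ∈ Icc (0 : ℝ) τ, 0 < (G (clock (x ^ 2) X u)).im := fun u hu ↦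
    im_pos_of_mem_timeDomain hÛ hζim hG (hdomG u hu)
  have hψc : ContinuousOn ψ (Icc 0 τ) := by
    have hP : Continuous fun u ↦ ((poleFlow (-x) X u : ℝ) : ℂ) :=
      continuous_ofReal.comp (continuous_poleFlow hXc hX0)
    have hd₁ : Continuous fun u ↦ ((poleDeriv X u : ℝ) : ℂ) :=
      continuous_ofReal.comp (continuous_poleDeriv hXc hX0)
    have hd₂ : Continuous fun u ↦ ((poleDeriv₂ X u : ℝ) : ℂ) :=
      continuous_ofReal.comp (continuous_poleDeriv₂ hXc hX0)
    have hGc : ContinuousOn (fun u ↦ G (clock (x ^ 2) X u)) (Icc 0 τ) :=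
      hG.continuousOn.comp (continuous_clock hXc hX0).continuousOn hdomG
    refine hP.continuousOn.sub ((continuousOn_const.mul hd₁.continuousOn).div
      (hGc.sub (continuousOn_const.sub ((continuousOn_const.mul hd₂.continuousOn).div
        (continuousOn_const.mul hd₁.continuousOn) fun u _ ↦ ?_))) fun u hu ↦ ?_)
    · exact mul_ne_zero two_ne_zero (Complex.ofReal_ne_zero.2 (poleDeriv_pos u).ne')
    · have hA : ((x : ℝ) : ℂ) - ((x ^ 2 : ℝ) : ℂ) * (poleDeriv₂ X u : ℂ) / (2 * (poleDeriv X u : ℂ)) =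
          ((x - x ^ 2 * poleDeriv₂ X u / (2 * poleDeriv X u) : ℝ) : ℂ) := by push_cast; ring
      rw [hA]
      exact sub_ne_zero.2 (ne_ofReal_of_im_pos (hGim u hu) _)
  -- `ψ = g` on `(0, τ)` and at `0`
  have hψg : ∀ u ∈ Ico (0 : ℝ) τ, ψ u = g u := by
    intro u hu
    rcases hu.1.eq_or_lt with h0 | h0
    · subst h0
      simp only [hψ]
      rw [clock_zero, hG.apply_zero, hg.apply_zero, hζ,
        retargetMoebius_eq_conjMap_zero x X (retargetMoebius.ne_neg_of_im_pos hz), conjMap]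
      exact invFormula_moebiusConjC (bd_ne_zero hx 0) (ne_ofReal_of_im_pos hz _)
    · have hu' : (⟨u, hu.1⟩ : ℝ≥0) < τ := by exact_mod_cast hu.2
      have h := hGg ⟨u, hu.1⟩ (by exact_mod_cast h0) hu'
      have h' : G (clock (x ^ 2) X u) = conjMap x (x ^ 2) (-x) X u (g u) := h
      simp only [hψ]
      rw [h', conjMap]
      have huT : ((u.toNNReal : ℝ≥0) : WithTop ℝ≥0) < swallowingTime W z := by
        rw [hτ]; exact WithTop.coe_lt_coe.2 ((Real.toNNReal_lt_iff_lt_coe hu.1).2 hu.2)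
      exact invFormula_moebiusConjC (bd_ne_zero hx u)
        (ne_ofReal_of_im_pos (IsSolution.im_pos_holds hW hg hz u hu.1 huT) _)
  -- the imaginary part of `ψ` is positive on `[0, τ]`
  have hψim : ∀ u ∈ Icc (0 : ℝ) τ, 0 < (ψ u).im := by
    intro u hu
    simp only [hψ]
    have hA : ((x : ℝ) : ℂ) - ((x ^ 2 : ℝ) : ℂ) * (poleDeriv₂ X u : ℂ) / (2 * (poleDeriv X u : ℂ)) =
        ((x - x ^ 2 * poleDeriv₂ X u / (2 * poleDeriv X u) : ℝ) : ℂ) := by push_cast; ring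
    have hc : ((x ^ 2 : ℝ) : ℂ) * (poleDeriv X u : ℂ) = ((x ^ 2 * poleDeriv X u : ℝ) : ℂ) := by
      push_cast; ring
    rw [hA, hc]
    exact im_invMoebius_pos (mul_pos (by positivity) (poleDeriv_pos u)) (hGim u hu)
  -- hence `im g ≥ δ > 0` on `[0, τ)`
  obtain ⟨u₀, hu₀, hmin⟩ := (isCompact_Icc (a := (0 : ℝ)) (b := τ)).exists_isMinOn
    ⟨0, left_mem_Icc.2 hτpos'.le⟩ ((Complex.continuous_im.comp_continuousOn hψc))
  set δ : ℝ := (ψ u₀).im with hδ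
  have hδpos : 0 < δ := hψim u₀ hu₀
  have hgτ : IsSolution W z g τ := by rw [← hτ]; exact hg
  obtain ⟨t, ht0, htτ, hlt'⟩ := hgτ.exists_norm_sub_lt hW hτpos hτ hδpos
  have h1 : δ ≤ (g t).im := by
    rw [← hψg t ⟨ht0, htτ⟩]; exact hmin ⟨ht0, htτ.le⟩
  have h2 : (g t).im ≤ ‖g t - W t.toNNReal‖ := by
    have := Complex.abs_im_le_norm (g t - W t.toNNReal)
    rw [sub_im, ofReal_im, sub_zero] at this
    exact (le_abs_self _).trans this
  linarith

/-! ### The hulls and the domains -/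

include hW hx hXc hX0 hu₁ hXW in
/-- **The image hull at the clock is the Möbius image of the hull**: `K̂_{clock t} = Φ_x(K_t)`
for `t ∈ (0, u₁]`. [cite: Lawler2005, §6.3] -/
theorem hull_image_eq {Û : ℝ≥0 → ℝ} (hÛ : Continuous Û)
    (hÛeq : ∀ r : ℝ, r ∈ Icc 0 (clock (x ^ 2) X u₁) → Û r.toNNReal = driver x (x ^ 2) X
      (invClock (x ^ 2) X u₁ r))
    {t : ℝ≥0} (ht0 : 0 < t) (ht : t ≤ u₁) :
    hull Û (clock (x ^ 2) X t).toNNReal = retargetMoebius x '' hull W t := by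
  have hb : (x ^ 2 : ℝ) ≠ 0 := pow_ne_zero 2 hx
  have hmono := (strictMono_clock hXc hX0 hb (b := x ^ 2)).monotone
  ext ζ
  constructor
  · rintro ⟨hζH, hζT⟩
    -- pull back by `Φ_{-x}`
    set w := retargetMoebius (-x) ζ with hw
    have hwH : 0 < w.im := retargetMoebius.im_pos (neg_ne_zero.2 hx) hζH
    have hζw : retargetMoebius x w = ζ := by
      have h := retargetMoebius.neg_apply_apply (neg_ne_zero.2 hx)
        (retargetMoebius.ne_neg_of_im_pos hζH)
      rwa [neg_neg] at h
    refine ⟨w, ⟨hwH, ?_⟩, hζw⟩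
    by_contra hgt
    rw [not_le] at hgt
    have h := coe_clock_lt_swallowingTime_image hW hx hXc hX0 hu₁ hXW hÛ hÛeq hwH ht0 ht hgt
    rw [hζw] at h
    exact absurd hζT (not_le.2 h)
  · rintro ⟨w, ⟨hwH, hwT⟩, rfl⟩
    have hwH' : 0 < w.im := hwH
    refine ⟨retargetMoebius.im_pos hx hwH', ?_⟩
    obtain ⟨τ, hτ⟩ := WithTop.ne_top_iff_exists.1 (ne_top_of_le_ne_top WithTop.coe_ne_top hwT)
    have hτt : τ ≤ t := by rw [← hτ] at hwT; exact WithTop.coe_le_coe.1 hwT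
    refine (swallowingTime_image_le hW hx hXc hX0 hu₁ hXW hÛ hÛeq hwH' hτ.symm (hτt.trans ht)).trans ?_
    exact WithTop.coe_le_coe.2 (Real.toNNReal_le_toNNReal (hmono (NNReal.coe_le_coe.2 hτt)))

include hW hx hXc hX0 hu₁ hXW in
/-- **The image Loewner domain is the Möbius image of the domain**: `Ĥ_{clock t} = Φ_x(H_t)`
for `t ∈ (0, u₁]`. [cite: Lawler2005, §6.3] -/
theorem domain_image_eq {Û : ℝ≥0 → ℝ} (hÛ : Continuous Û)
    (hÛeq : ∀ r : ℝ, r ∈ Icc 0 (clock (x ^ 2) X u₁) → Û r.toNNReal = driver x (x ^ 2) X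
      (invClock (x ^ 2) X u₁ r))
    {t : ℝ≥0} (ht0 : 0 < t) (ht : t ≤ u₁) :
    domain Û (clock (x ^ 2) X t).toNNReal = retargetMoebius x '' domain W t := by
  have hhull := hull_image_eq hW hx hXc hX0 hu₁ hXW hÛ hÛeq ht0 ht
  ext ζ
  simp only [domain, Set.mem_sdiff]
  constructor
  · rintro ⟨hζH, hζK⟩
    set w := retargetMoebius (-x) ζ with hw
    have hwH : 0 < w.im := retargetMoebius.im_pos (neg_ne_zero.2 hx) hζH
    have hζw : retargetMoebius x w = ζ := by
      have h := retargetMoebius.neg_apply_apply (neg_ne_zero.2 hx)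
        (retargetMoebius.ne_neg_of_im_pos hζH)
      rwa [neg_neg] at h
    refine ⟨w, ⟨hwH, fun hwK ↦ hζK ?_⟩, hζw⟩
    rw [hhull]; exact ⟨w, hwK, hζw⟩
  · rintro ⟨w, ⟨hwH, hwK⟩, rfl⟩
    have hwH' : 0 < w.im := hwH
    refine ⟨retargetMoebius.im_pos hx hwH', fun hK ↦ hwK ?_⟩
    rw [hhull] at hK
    obtain ⟨w', hw'K, heq⟩ := hK
    have hinj := retargetMoebius.neg_apply_apply hx (retargetMoebius.ne_neg_of_im_pos hwH')
    rw [← heq, retargetMoebius.neg_apply_apply hx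
      (retargetMoebius.ne_neg_of_im_pos (hull_subset W t hw'K))] at hinj
    rw [← hinj]; exact hw'K

/-! ### The trace -/

include hW hx hXc hX0 hu₁ hXW in
/-- **The generating curve of the image chain is the Möbius image of the generating curve, in
capacity time**: if the chain of `W` is generated by `γ`, the chain of `Û` by `γ̂`, and `γ`
avoids the pole `-x` at the time `t ∈ (0, u₁]`, then `γ̂(clock t) = Φ_x(γ(t))`. Proof: the tips
are the boundary limits of the inverse Loewner maps at the driving values
(`IsGeneratedByCurve.tendsto_invFunOn_map`); the inverse image map is `Φ_x ∘ f_t ∘ h_t⁻¹` on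
`ℍ` (`map_image_eq_conjMap`, `injOn_map`), and `h_t⁻¹(w) → W_t` within `ℍ` as `w → Û_{clock t}
= h_t(W_t)`. [cite: Lawler2005, §6.3] -/
theorem trace_image_eq {Û : ℝ≥0 → ℝ} (hÛ : Continuous Û)
    (hÛeq : ∀ r : ℝ, r ∈ Icc 0 (clock (x ^ 2) X u₁) → Û r.toNNReal = driver x (x ^ 2) X
      (invClock (x ^ 2) X u₁ r))
    {γ γ' : ℝ≥0 → ℂ} (hγ : IsGeneratedByCurve W γ) (hγ' : IsGeneratedByCurve Û γ')
    {t : ℝ≥0} (ht0 : 0 < t) (ht : t ≤ u₁) (hγt : γ t ≠ -x) :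
    γ' (clock (x ^ 2) X t).toNNReal = retargetMoebius x (γ t) := by
  have hb : (x ^ 2 : ℝ) ≠ 0 := pow_ne_zero 2 hx
  have hu₁0 : (0 : ℝ) ≤ u₁ := u₁.coe_nonneg
  set S := clock (x ^ 2) X t with hSdef
  have hS0 : 0 ≤ S := clock_nonneg hXc hX0 hb t.coe_nonneg
  have hScoe : ((S.toNNReal : ℝ≥0) : ℝ) = S := Real.coe_toNNReal _ hS0
  have htI : (t : ℝ) ∈ Icc 0 (u₁ : ℝ) := ⟨t.coe_nonneg, by exact_mod_cast ht⟩
  have hSI : S ∈ Icc 0 (clock (x ^ 2) X u₁) :=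
    ⟨hS0, (strictMono_clock hXc hX0 hb (b := x ^ 2)).monotone htI.2⟩
  -- the driving values: `Û S = h_t(W t)`
  have hPX : poleFlow (-x) X t - X t = W t := by
    have := poleFlow_sub_X_eq hW hu₁ hXW htI; rwa [Real.toNNReal_coe] at this
  have hÛS : (Û S.toNNReal : ℂ) = conjMap x (x ^ 2) (-x) X t (W t) := by
    rw [hÛeq S hSI, invClock_clock hXc hX0 hb hu₁0 ⟨by linarith [htI.1], by linarith [htI.2]⟩,
      ← hPX, conjMap_driving]
  -- the inverse Möbius map `ψ = h_t⁻¹`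
  set A : ℝ := x - x ^ 2 * poleDeriv₂ X t / (2 * poleDeriv X t) with hA
  set ψ : ℂ → ℂ := fun w ↦ ((poleFlow (-x) X t : ℝ) : ℂ) -
    ((x ^ 2 * poleDeriv X t : ℝ) : ℂ) / (w - A) with hψ
  have hAc : ((x : ℝ) : ℂ) - ((x ^ 2 : ℝ) : ℂ) * (poleDeriv₂ X t : ℂ) / (2 * (poleDeriv X t : ℂ)) =
      (A : ℂ) := by simp only [hA]; push_cast; ring
  have hcc : ((x ^ 2 : ℝ) : ℂ) * (poleDeriv X t : ℂ) = ((x ^ 2 * poleDeriv X t : ℝ) : ℂ) := by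
    push_cast; ring
  have hψinv : ∀ y : ℂ, y ≠ poleFlow (-x) X t → ψ (conjMap x (x ^ 2) (-x) X t y) = y := by
    intro y hy
    simp only [hψ]
    rw [conjMap, ← hAc, ← hcc]
    exact invFormula_moebiusConjC (bd_ne_zero hx t) hy
  have hinvψ : ∀ w : ℂ, 0 < w.im → conjMap x (x ^ 2) (-x) X t (ψ w) = w := by
    intro w hw
    simp only [hψ]
    rw [conjMap, ← hAc, ← hcc]
    exact moebiusConjC_invFormula (bd_ne_zero hx t) (by rw [hAc]; exact ne_ofReal_of_im_pos hw _)
  have hψH : ∀ w : ℂ, 0 < w.im → 0 < (ψ w).im := fun w hw ↦ by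
    simp only [hψ]; exact im_invMoebius_pos (mul_pos (by positivity) (poleDeriv_pos t)) hw
  -- `ψ` is continuous at `Û S = h_t(W t)` with value `W t`, and maps `ℍ` into `ℍ`
  have hWP : (W t : ℂ) ≠ poleFlow (-x) X t := by
    intro h
    have h' : W t = poleFlow (-x) X t := by exact_mod_cast h
    exact hX0 t (by linarith)
  have hψÛ : ψ (Û S.toNNReal) = W t := by rw [hÛS]; exact hψinv _ hWP
  have hAfar : A = farPoint x (x ^ 2) X t := by
    simp only [hA, farPoint, poleDeriv₂]
    have hd : poleDeriv X t ≠ 0 := (poleDeriv_pos t).ne'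
    field_simp
  have hψcont : ContinuousAt ψ (Û S.toNNReal : ℂ) := by
    simp only [hψ]
    refine continuousAt_const.sub (continuousAt_const.div (continuousAt_id.sub continuousAt_const) ?_)
    rw [hÛS, ← hPX, conjMap_driving]
    intro h
    have h' : driver x (x ^ 2) X t = A := by
      have := sub_eq_zero.1 h; exact_mod_cast this
    have h2 := farPoint_sub_driver (a := x) (b := x ^ 2) (X := X) t
    rw [h', hAfar, sub_self] at h2
    have hne : x ^ 2 * poleDeriv X t / X t ≠ 0 :=
      div_ne_zero (mul_ne_zero hb (poleDeriv_pos t).ne') (hX0 t)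
    exact hne (by linarith)
  have hψtend : Tendsto ψ (𝓝[upperHalfPlaneSet] (Û S.toNNReal : ℂ))
      (𝓝[upperHalfPlaneSet] (W t : ℂ)) := by
    rw [← hψÛ]
    exact hψcont.continuousWithinAt.tendsto_nhdsWithin fun w hw ↦ hψH w hw
  -- the two tip limits
  have hlimW := hγ.tendsto_invFunOn_map hW t
  have hlimÛ := hγ'.tendsto_invFunOn_map hÛ S.toNNReal
  -- the inverse image map on `ℍ` is `Φ_x ∘ f_t ∘ ψ`
  have hkey : ∀ w ∈ upperHalfPlaneSet, Function.invFunOn (map Û S.toNNReal) (domain Û S.toNNReal) w =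
      retargetMoebius x (Function.invFunOn (map W t) (domain W t) (ψ w)) := by
    intro w hw
    have hw' : 0 < w.im := hw
    set z := Function.invFunOn (map W t) (domain W t) (ψ w) with hz
    have hbij := bijOn_invFunOn_map hW t
    have hzdom : z ∈ domain W t := hbij.mapsTo (hψH w hw')
    have hmapz : map W t z = ψ w := (bijOn_map hW t).invOn_invFunOn.2 (hψH w hw')
    rw [mem_domain_iff] at hzdom
    have hzim : 0 < z.im := hzdom.1
    have h1 := map_image_eq_conjMap hW hx hXc hX0 hu₁ hXW hÛ hÛeq hzim ht0 ht hzdom.2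
    rw [hmapz, hinvψ w hw'] at h1
    -- `Φ_x z` lies in the image domain and is mapped to `w`
    have halive := coe_clock_lt_swallowingTime_image hW hx hXc hX0 hu₁ hXW hÛ hÛeq hzim ht0 ht hzdom.2
    have hmem : retargetMoebius x z ∈ domain Û S.toNNReal :=
      (mem_domain_iff _ _ _).2 ⟨retargetMoebius.im_pos hx hzim, halive⟩
    have hbijÛ := bijOn_map hÛ S.toNNReal
    have hw_im : w ∈ map Û S.toNNReal '' domain Û S.toNNReal := ⟨_, hmem, h1⟩
    have hpre := Function.invFunOn_eq hw_im
    have hpmem := Function.invFunOn_mem hw_im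
    exact hbijÛ.injOn hpmem hmem (hpre.trans h1.symm)
  -- conclude by uniqueness of limits along `𝓝[ℍ] (Û S)`
  haveI := neBot_nhdsWithin_ofReal (Û S.toNNReal)
  have hcomp : Tendsto (fun w ↦ retargetMoebius x (Function.invFunOn (map W t) (domain W t) (ψ w)))
      (𝓝[upperHalfPlaneSet] (Û S.toNNReal : ℂ)) (𝓝 (retargetMoebius x (γ t))) :=
    ((retargetMoebius.continuousAt hγt).tendsto.comp (hlimW.comp hψtend))
  have hlimÛ' : Tendsto (Function.invFunOn (map Û S.toNNReal) (domain Û S.toNNReal))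
      (𝓝[upperHalfPlaneSet] (Û S.toNNReal : ℂ)) (𝓝 (retargetMoebius x (γ t))) :=
    hcomp.congr' (eventuallyEq_nhdsWithin_of_eqOn fun w hw ↦ (hkey w hw).symm)
  exact tendsto_nhds_unique hlimÛ hlimÛ'

end Transport

end MoebiusTransport

end Literature.Probability.RandomPlanarGeometry

end
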